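import Literature.Geometry.Kaehler.ComplexTorusAbelianThreefoldTimesEllipticCurveHodgeGroup
import HarnessLib

/-!
# Moonen–Zarhin's case (a) intrinsically: «an embedding `k ↪ End⁰(X₂)`» of the imaginary quadratic field
# `k = ℚ(τ) = End⁰(E_τ)` into the centre `F` of `End⁰(T)` ⟺ some complex embedding of `F` takes the value `τ`;
# Thm. (0.1) (4) for `T × E_τ` under «no embedding `k ↪ F`»

Layer `Literature/Geometry/Kaehler`, namespace `Literature.Geometry.Kaehler.ComplexTorus`; lane `lit-hodgefound`
(Track 2 foundations library), Layer A4 (known cases of `D = B`), prover seat `lit-hodgefound-p17` (generation 51),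
self-proposed row g51-#10.  g51-#5 … #9 phrase «not in case (a)» for `X = T × E_τ` (`T` a simple threefold, `E_τ` with
complex multiplication by `k = ℚ(τ)`) as «no ring embedding `φ : F → ℂ` of the centre `F = centerField` of `End⁰(T)`
has `φ(c) = τ`».  Moonen–Zarhin's own condition is «there exists an embedding `k ↪ End⁰(X₂)`» (for a simple threefold
`End⁰(X₂) = F`, g51-#4) ∕ «an embedding of `k` into the center of `End⁰(X)`» (Prop. (3.8)).  This file proves the two
are equivalent — a `ℚ`-algebra map `ℚ[τ] → F` exists iff some complex embedding of `F` takes the value `τ` (for `τ`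
imaginary quadratic; «⟸» for any `τ`) — and restates Thm. (0.1) (4) for `T × E_τ` under the intrinsic hypothesis
`IsEmpty (ℚ[τ] →ₐ[ℚ] F)`.  THEOREMS ONLY (no definition, no instance, no notation, no named fact; D-0026, net debt 0).

## Sources, VERBATIM (held `paper:arxiv-math_9901113`)

* B. J. J. Moonen, Yu. G. Zarhin [MoonenZarhin1999LowDim], *Hodge classes on abelian varieties of low dimension*, Math.
  Ann. **315** (1999).  Introduction, case (a) (p0001 L77–L80): «The abelian variety `X` is isogenous to a product
  `X₁ × X₂` where `X₁` is an elliptic curve with complex multiplication by an imaginary quadratic field `k` and where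
  `X₂` is a simple abelian threefold such that there exists an embedding `k ↪ End⁰(X₂)`.»; §3 Prop. (3.8) (p0007
  L55–L74): «… there exists an embedding of `k` into the center of `End⁰(X)` … there exists an embedding `k → F_i`»;
  Thm. (0.1) (4) (p0001 L131–L135); §5 (5.5) (p0009 L93–L97): «If we are not in case (a) then there is no embedding of
  `End⁰(X₁)` into the center of `End⁰(X₂)`».
* H. Lange [Lange2023AbelianVarietiesComplex], *Abelian Varieties over the Complex Numbers* (2023), §5.1.5 Exercise (1)
  (`End_ℚ(E_τ) = ℚ(τ)` imaginary quadratic for a CM curve), §2.6.1 (the centre `F` of `End_ℚ(X)`: a totally real or a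
  CM number field).

## The field-theoretic argument

«⟹»: a `ℚ`-algebra map `ι : ℚ[τ] → F` gives `c = ι(τ) ∈ F` with `c² + pc + q = 0` (`τ² + pτ + q = 0` over `ℚ`); for
any complex embedding `φ₀` of the number field `F`, `φ₀(c) ∈ {τ, τ̄}` (the two roots, `τ̄ = −p − τ` as `τ ∉ ℝ`), and
`φ₀` or `conj ∘ φ₀` takes the value `τ` at `c`.  «⟸»: if `φ(c) = τ` then `ℚ[τ] ⊆ φ(F) ≅ F`, and the inverse of `φ` on
its range restricts to `ℚ[τ] → F`.

## Contents

* §1 (any field `K` of characteristic `0` ∕ number field `K`) `nonempty_algHom_adjoin_of_ringHom_apply_eq`,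
  `exists_ringHom_apply_eq_of_algHom_adjoin`, **`nonempty_algHom_adjoin_iff_exists_ringHom_apply_eq`**.
* §2 (simple `X`) **`IsSimple.isEmpty_algHom_adjoin_centerField_iff`**: «no embedding `k ↪ F`» ⟺ `∀ φ c, φ c ≠ τ`;
  Thm. (0.1) (4) for `T × E_τ` under «no embedding `ℚ[τ] ↪ F` when `T` is simple»:
  **`IsRiemannForm.forall_divisorClasses_powPeriod_prod_ellipticPeriod_eq_hodgeClasses_of_finrank_eq_three_of_isEmpty_algHom`**,
  `IsSimple.hodgeGroupC_prod_ellipticPeriod_eq_blockDiagProd_of_isEmpty_algHom` (any dimension `≠ 1`),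
  `IsRiemannForm.hodgeGroup_prod_ellipticPeriod_eq_lefschetzGroup_of_finrank_eq_three_of_isEmpty_algHom`.
-/

noncomputable section

open Module Matrix NumberField

namespace Literature.Geometry.Kaehler

namespace ComplexTorus

/-! ## §1 `ℚ[τ] ↪ K` ⟺ some complex embedding of `K` takes the value `τ` -/

section Field

variable {K : Type*} [Field K] [CharZero K]

/-- **If a ring embedding `φ : K → ℂ` takes the value `τ`, then `ℚ[τ]` embeds into `K`** (`ℚ[τ] ⊆ φ(K) ≅ K`).
[cite: MoonenZarhin1999LowDim, §3 Prop. (3.8) (p0007 L55–L74: «an embedding of `k` into the center of `End⁰(X)`») and Introduction, case (a) (p0001 L77–L80)] -/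
theorem nonempty_algHom_adjoin_of_ringHom_apply_eq (φ : K →+* ℂ) {c : K} {τ : ℂ} (h : φ c = τ) :
    Nonempty (Algebra.adjoin ℚ {τ} →ₐ[ℚ] K) := by
  have hle : Algebra.adjoin ℚ {τ} ≤ φ.toRatAlgHom.range :=
    Algebra.adjoin_le (Set.singleton_subset_iff.2 ((AlgHom.mem_range _).2 ⟨c, h⟩))
  exact ⟨((AlgEquiv.ofInjective φ.toRatAlgHom φ.injective).symm : φ.toRatAlgHom.range →ₐ[ℚ] K).comp
    (Subalgebra.inclusion hle)⟩

end Field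

section NumberField

variable {K : Type*} [Field K] [NumberField K]

/-- **Conversely, for `τ` imaginary quadratic (`τ² + pτ + q = 0` over `ℚ`, `τ ∉ ℝ`): an embedding `ι : ℚ[τ] → K` into a
number field `K` yields a complex embedding `φ` of `K` with `φ(ι(τ)) = τ`** — any complex embedding `φ₀` has
`φ₀(ι τ) ∈ {τ, τ̄ = −p − τ}`, and `φ₀` or `conj ∘ φ₀` will do.
[cite: MoonenZarhin1999LowDim, Introduction, case (a) (p0001 L77–L80) and §3 Prop. (3.8) (p0007 L65–L74)] [cite: Lange2023AbelianVarietiesComplex, §5.1.5 Exercise (1)] -/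
theorem exists_ringHom_apply_eq_of_algHom_adjoin {τ : ℂ} (hτ : τ.im ≠ 0) {p q : ℚ} (hpq : τ ^ 2 + p * τ + q = 0)
    (ι : Algebra.adjoin ℚ {τ} →ₐ[ℚ] K) :
    ∃ φ : K →+* ℂ, φ (ι ⟨τ, Algebra.subset_adjoin (Set.mem_singleton τ)⟩) = τ := by
  set t : Algebra.adjoin ℚ {τ} := ⟨τ, Algebra.subset_adjoin (Set.mem_singleton τ)⟩ with ht_def
  -- the relation `t² + p t + q = 0` in `ℚ[τ]`, transported to `c = ι t ∈ K`
  have ht : t ^ 2 + algebraMap ℚ _ p * t + algebraMap ℚ _ q = 0 := by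
    apply Subtype.ext
    simp only [Subalgebra.coe_add, Subalgebra.coe_mul, Subalgebra.coe_pow, Subalgebra.coe_algebraMap, Subalgebra.coe_zero,
      ht_def, eq_ratCast]
    exact hpq
  have hc : ι t ^ 2 + algebraMap ℚ K p * ι t + algebraMap ℚ K q = 0 := by
    have h := congrArg ι ht
    rwa [map_add, map_add, map_mul, map_pow, AlgHom.commutes, AlgHom.commutes, map_zero] at h
  -- any complex embedding `φ₀`; `z = φ₀(c)` is a root: `(z - τ)(z + p + τ) = 0`
  obtain ⟨w⟩ := (inferInstance : Nonempty (InfinitePlace K))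
  set z : ℂ := w.embedding (ι t) with hz_def
  have hz : z ^ 2 + p * z + q = 0 := by
    have h := congrArg w.embedding hc
    have hp : w.embedding (algebraMap ℚ K p) = (p : ℂ) := eq_ratCast (w.embedding.comp (algebraMap ℚ K)) p
    have hq : w.embedding (algebraMap ℚ K q) = (q : ℂ) := eq_ratCast (w.embedding.comp (algebraMap ℚ K)) q
    rw [map_add, map_add, map_mul, map_pow, map_zero, hp, hq] at h
    exact h
  have hprod : (z - τ) * (z + p + τ) = 0 := by linear_combination hz - hpq
  rcases mul_eq_zero.1 hprod with h | h
  · exact ⟨w.embedding, sub_eq_zero.1 h⟩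
  · -- `z = -p - τ = conj τ` (the other root; `τ ∉ ℝ`), so `conj ∘ φ₀` takes the value `τ`
    have hconjroot : (starRingEnd ℂ τ - τ) * (starRingEnd ℂ τ + p + τ) = 0 := by
      have h1 : starRingEnd ℂ τ ^ 2 + p * starRingEnd ℂ τ + q = 0 := by
        have h2 := congrArg (starRingEnd ℂ) hpq
        simpa using h2
      linear_combination h1 - hpq
    have hne : starRingEnd ℂ τ - τ ≠ 0 := fun h0 ↦ hτ (Complex.conj_eq_iff_im.1 (sub_eq_zero.1 h0))
    have hconj : starRingEnd ℂ τ = -p - τ := by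
      have h3 := (mul_eq_zero.1 hconjroot).resolve_left hne
      linear_combination h3
    refine ⟨(starRingEnd ℂ).comp w.embedding, ?_⟩
    rw [RingHom.comp_apply, ← hz_def, show z = -p - τ by linear_combination h, map_sub, map_neg, map_ratCast,
      hconj]
    ring

/-- **`ℚ[τ]` embeds into the number field `K` iff some complex embedding of `K` takes the value `τ`** (`τ` imaginary
quadratic). [cite: MoonenZarhin1999LowDim, Introduction, case (a) (p0001 L77–L80) and §3 Prop. (3.8) (p0007 L55–L74)] -/
theorem nonempty_algHom_adjoin_iff_exists_ringHom_apply_eq {τ : ℂ} (hτ : τ.im ≠ 0) {p q : ℚ}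
    (hpq : τ ^ 2 + p * τ + q = 0) :
    Nonempty (Algebra.adjoin ℚ {τ} →ₐ[ℚ] K) ↔ ∃ φ : K →+* ℂ, ∃ c : K, φ c = τ := by
  constructor
  · rintro ⟨ι⟩
    obtain ⟨φ, hφ⟩ := exists_ringHom_apply_eq_of_algHom_adjoin hτ hpq ι
    exact ⟨φ, _, hφ⟩
  · rintro ⟨φ, c, h⟩
    exact nonempty_algHom_adjoin_of_ringHom_apply_eq φ h

end NumberField

/-! ## §2 Case (a) for a simple `X`: «an embedding `k ↪ F`», `F` the centre of `End⁰(X)` -/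

section Simple

variable {κ : Type} [Fintype κ] [DecidableEq κ] [Nonempty κ] {E : Type} [NormedAddCommGroup E] [NormedSpace ℂ E]
  {Ψ : (κ → ℝ) ≃L[ℝ] E} {η : E [⋀^Fin 2]→L[ℝ] ℝ} {τ : ℂ} (hτ : τ.im ≠ 0)

/-- **«NO EMBEDDING `k = ℚ(τ) ↪ F`» (`F` the centre of `End⁰(X)`, `X` simple, `E_τ` with complex multiplication) IS
EQUIVALENT TO «no complex embedding of `F` takes the value `τ`»**, the hypothesis of g51-#5 … #9.
[cite: MoonenZarhin1999LowDim, Introduction, case (a) (p0001 L77–L80), §3 Prop. (3.8) (p0007 L55–L74) and §5 (5.5) (p0009 L93–L97)]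
[cite: Lange2023AbelianVarietiesComplex, §2.6.1 and §5.1.5 Exercise (1)] -/
theorem IsSimple.isEmpty_algHom_adjoin_centerField_iff (hX : IsSimple Ψ) (hCM : ellipticEnd hτ ≠ ⊥) :
    IsEmpty (Algebra.adjoin ℚ {τ} →ₐ[ℚ] centerField Ψ hX) ↔ ∀ φ : centerField Ψ hX →+* ℂ, ∀ c, φ c ≠ τ := by
  obtain ⟨p, q, hpq⟩ := (ellipticEnd_ne_bot_iff hτ).1 hCM
  rw [← not_nonempty_iff, nonempty_algHom_adjoin_iff_exists_ringHom_apply_eq hτ hpq]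
  simp only [not_exists]

omit [Nonempty κ] in
/-- Without complex multiplication the question does not arise; with it, **«no embedding `ℚ[τ] ↪ F`» gives
`∀ φ c, φ c ≠ τ`** in the form consumed by g51-#5. [cite: MoonenZarhin1999LowDim, Introduction, case (a) (p0001 L77–L80)] -/
theorem IsSimple.forall_ringHom_centerField_apply_ne_of_isEmpty_algHom [Nonempty κ] (hX : IsSimple Ψ)
    (hCM : ellipticEnd hτ ≠ ⊥) (h : IsEmpty (Algebra.adjoin ℚ {τ} →ₐ[ℚ] centerField Ψ hX)) :
    ∀ φ : centerField Ψ hX →+* ℂ, ∀ c, φ c ≠ τ :=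
  (hX.isEmpty_algHom_adjoin_centerField_iff hτ hCM).1 h

/-- **(3.8) FOR A SIMPLE `X` OF DIMENSION `≠ 1` UNDER «NO EMBEDDING `k ↪ F`»: `Hg(X × E_τ)(ℂ) = Hg(X)(ℂ) × Hg(E_τ)(ℂ)`**
for every elliptic curve `E_τ` such that, if `E_τ` has complex multiplication, `ℚ[τ]` does not embed into the centre
`F` of `End⁰(X)`. [cite: MoonenZarhin1999LowDim, §3 Prop. (3.8) (p0007 L55–L74) and §5 (5.5) (p0009 L93–L97)] -/
theorem IsSimple.hodgeGroupC_prod_ellipticPeriod_eq_blockDiagProd_of_isEmpty_algHom (hX : IsSimple Ψ)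
    (hη : IsRiemannForm Ψ η) (hcard : Fintype.card κ ≠ 2)
    (ha : ellipticEnd hτ ≠ ⊥ → IsEmpty (Algebra.adjoin ℚ {τ} →ₐ[ℚ] centerField Ψ hX)) :
    hodgeGroupC (prodPeriod Ψ (ellipticPeriod hτ)) = blockDiagProd (hodgeGroupC Ψ) (hodgeGroupC (ellipticPeriod hτ)) := by
  by_cases hE : ellipticEnd hτ = ⊥
  · exact hX.hodgeGroupC_prod_ellipticPeriod_eq_blockDiagProd_of_card_ne hτ ⟨η, hη⟩ hE hcard
  · exact hX.hodgeGroupC_prod_ellipticPeriod_eq_blockDiagProd_of_forall_apply_ne hτ hη hE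
      (hX.forall_ringHom_centerField_apply_ne_of_isEmpty_algHom hτ hE (ha hE))

end Simple

section Threefold

variable {κ : Type} [Fintype κ] [DecidableEq κ] [Nonempty κ] {E : Type} [NormedAddCommGroup E] [NormedSpace ℂ E]
  [FiniteDimensional ℂ E] {Ψ : (κ → ℝ) ≃L[ℝ] E} {η : E [⋀^Fin 2]→L[ℝ] ℝ} {τ : ℂ} (hτ : τ.im ≠ 0)
  {θ : (E × ℂ) [⋀^Fin 2]→L[ℝ] ℝ}

/-- **MOONEN–ZARHIN THM. (0.1) (4) FOR `X = T × E_τ` OUTSIDE CASE (a), WITH CASE (a) AS PRINTED: `T × E_τ` satisfies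
condition (D) — `ℬ•((T × E_τ)ⁿ) = 𝒟•((T × E_τ)ⁿ)` for all `n` — for every polarised complex abelian threefold `T` and
every elliptic curve `E_τ`, unless `T` is simple, `E_τ` has complex multiplication by `k = ℚ(τ)` and «there exists an
embedding `k ↪ End⁰(X₂)`» (`= F`, the centre, for a simple threefold).**
[cite: MoonenZarhin1999LowDim, Thm. (0.1) (4) (p0001 L131–L135), case (a) (p0001 L77–L80) and §5 (5.4)–(5.5) (p0009 L82–L97)] [cite: Gordon1997, Thm. 7.5] -/
theorem IsRiemannForm.forall_divisorClasses_powPeriod_prod_ellipticPeriod_eq_hodgeClasses_of_finrank_eq_three_of_isEmpty_algHom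
    (hη : IsRiemannForm Ψ η) (h3 : finrank ℂ E = 3)
    (ha : ∀ hX : IsSimple Ψ, ellipticEnd hτ ≠ ⊥ → IsEmpty (Algebra.adjoin ℚ {τ} →ₐ[ℚ] centerField Ψ hX)) :
    ∀ k p, divisorClasses (powPeriod (prodPeriod Ψ (ellipticPeriod hτ)) k) p =
      hodgeClasses (powPeriod (prodPeriod Ψ (ellipticPeriod hτ)) k) p :=
  hη.forall_divisorClasses_powPeriod_prod_ellipticPeriod_eq_hodgeClasses_of_finrank_eq_three_of_forall_apply_ne hτ h3
    fun hX hE ↦ hX.forall_ringHom_centerField_apply_ne_of_isEmpty_algHom hτ hE (ha hX hE)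

/-- **… and «`Hg(X) = Sp_D(V,φ)`»: `Hg(T × E_τ)(ℝ) = S(T × E_τ)(ℝ)` for every polarisation, outside case (a) as printed.**
[cite: MoonenZarhin1999LowDim, Thm. (0.1) (4) (p0001 L131–L135) and case (a) (p0001 L77–L80)] [cite: Gordon1997, Thm. 7.5] -/
theorem IsRiemannForm.hodgeGroup_prod_ellipticPeriod_eq_lefschetzGroup_of_finrank_eq_three_of_isEmpty_algHom
    (hθ : IsRiemannForm (prodPeriod Ψ (ellipticPeriod hτ)) θ) (hη : IsRiemannForm Ψ η) (h3 : finrank ℂ E = 3)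
    (ha : ∀ hX : IsSimple Ψ, ellipticEnd hτ ≠ ⊥ → IsEmpty (Algebra.adjoin ℚ {τ} →ₐ[ℚ] centerField Ψ hX)) :
    hodgeGroup (prodPeriod Ψ (ellipticPeriod hτ)) = lefschetzGroup (prodPeriod Ψ (ellipticPeriod hτ)) θ :=
  hθ.hodgeGroup_prod_ellipticPeriod_eq_lefschetzGroup_of_finrank_eq_three_of_forall_apply_ne hτ hη h3
    fun hX hE ↦ hX.forall_ringHom_centerField_apply_ne_of_isEmpty_algHom hτ hE (ha hX hE)

omit [FiniteDimensional ℂ E] in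
/-- **CASE (a) DETECTED BY THE HODGE GROUP: if `Hg(T × E_τ)(ℂ) ≠ Hg(T)(ℂ) × Hg(E_τ)(ℂ)` for a simple polarised threefold
`T` and a CM curve `E_τ`, then `k = ℚ(τ)` embeds into the centre `F` of `End⁰(T)`** (Prop. (3.8) for simple `X`, with
its conclusion as printed). [cite: MoonenZarhin1999LowDim, §3 Prop. (3.8) (p0007 L55–L74) and Introduction, case (a) (p0001 L77–L80)] -/
theorem IsSimple.nonempty_algHom_adjoin_centerField_of_hodgeGroupC_prod_ellipticPeriod_ne (hX : IsSimple Ψ)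
    (hη : IsRiemannForm Ψ η) (hCM : ellipticEnd hτ ≠ ⊥)
    (hne : hodgeGroupC (prodPeriod Ψ (ellipticPeriod hτ)) ≠ blockDiagProd (hodgeGroupC Ψ) (hodgeGroupC (ellipticPeriod hτ))) :
    Nonempty (Algebra.adjoin ℚ {τ} →ₐ[ℚ] centerField Ψ hX) := by
  by_contra h
  rw [not_nonempty_iff] at h
  exact hne (hX.hodgeGroupC_prod_ellipticPeriod_eq_blockDiagProd_of_forall_apply_ne hτ hη hCM
    (hX.forall_ringHom_centerField_apply_ne_of_isEmpty_algHom hτ hCM h))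

end Threefold

end ComplexTorus

end Literature.Geometry.Kaehler
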